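import Mathlib
import HarnessLib
import Summits.ValiantsHypothesis.ValiantsHypothesis.Theorems.LacunarySymmetroidMatrixDescartesProductPlusOneSlopeMixedCloud
import Summits.ValiantsHypothesis.ValiantsHypothesis.Theorems.LacunarySymmetroidMatrixDescartesProductPlusOneWWIdentity

/-!
# LINE (A) `product_plus_one` — the ONE-BUMP cell with a MIXED-RATE background, tower currency: one pointwise law for every
# background row, one for every bump row (from the W∘W identity ✓ `rowPsi_det13_eq`), and the hump-vs-background count

Crux item stmt-ValiantsHypothesis-18050, W-budget frame EB2-W; owner memo §21 (`MixedRateOneBumpCellK3`, owner p7 g17).  Notation of ✓ `…CloudDefs`: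
row `A − Bx^p − Cx^q` (`p = e₁+1`, `q = e₁+e₂+2`), `u = rowU = 1/(A − Bx^p − Cx^q)`, `β = Bx^p`, `γ = Cx^q`, `ψ_k = rowPsi_k` (the row's field
`W(f)/f² = −ψ₁`, ✓ `logWronskian_row_eq_rowPsi1`), cloud sums `cloudP1/2/3`.

§1 THE TWO LAWS (every real `A, B, C`, every `x` off the row's zero; the identity is ✓ `rowPsi_det13_eq` of ✓ `…WWIdentity` (val-port-4 g4):
`ψ₁ψ₃ − ψ₂² = 2ψ₁³ + (pq(q−p))²·ABC·x^{p+q}·u³`, the tower form of the owner's W∘W identity `(log|F|)″ = −2F + Δ²abc·x^{Σe}·g/W(g)²`):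
* `background_law` — BACKGROUND at `x`: `ψ₁ > 0` and `βγ·(A·u) ≥ 0` (the letter grouping of ✓ `slope_logConcave_of_sign`) ⇒ `ψ₃ > 0` and
  `ψ₂² ≤ ψ₁ψ₃` — a two-line corollary of ✓ `rowPsi_logConvex_of` (`(log ψ₁)″ ≥ 2ψ₁`); the BUMP law (`ψ₁ < 0`, `βγ·(A·u) ≤ 0` ⇒ `ψ₁ψ₃ < ψ₂²`) is
  ✓ `slope_logConcave_of_sign` (= ✓ `rowPsi_logConcave_of`).
* binomial rows: `pair01_rowPsi1_eq` (`C = 0`: `ψ₁ = p²·β·A·u²`), `pair12_rowPsi1_eq` (`A = 0`: `ψ₁ = −(q−p)²·βγ·u²`) and ✓ `knee_rowPsi1_eq`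
  (`B = 0`: `ψ₁ = q²·γ·A·u²`): a one-change binomial on ANY pair is background on both sides of its root, a one-signed binomial on any pair is a bump,
  and for all of them `βγ·(A·u) = 0`.
§2 `backgroundCloud_lcP1` — a weighted cloud whose rows satisfy the background law pointwise has `P1 > 0` and `P2² ≤ P1·P3` (✓ `lc_sum`).
§3 ★★ `hump_backgroundCloud_no_three_zeros` — a row with `ψ₁ < 0`, `βγ·(A·u) ≤ 0` on `[x₁,x₃] ⊂ (0,∞)` against such a cloud: `ψ₁ + cloudP1` has NO
  THREE ZEROS (✓ engine `slope_no_three_zeros_of_pull`).  The LINE-currency menu (binomial risers on any pair, incoherent cloud, switched coherent rows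
  | binomial knee on any pair, switched incoherent riser, rising coherent row) is unfolded onto these laws in `…ProductPlusOneOneBumpLine` / `…OneBumpCount`.
§4 two one-row tools for that menu: `binomial_sign_const` (`α + βx^n` with `g(u)g(v) > 0` keeps its sign on `[u,v]`) and `coherent_rowPsi1_neg_of_lt`
  (unswitched coherent row: `ψ₁(x₃) ≤ 0 ⇒ ψ₁ < 0` on `(0,x₃)` — its slope form is `u²x^p·k(x)` with `k` strictly increasing).

Relation: ✓ `puller_slope_logConvex`, ✓ `switchedCoherent_slope_logConvex`, ✓ `switchedPole_signs`, ✓ `mixedCloud_lcP1`, ✓ `poleCloud_lcP1` are the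
type-by-type instances of `background_law`.  HONEST FRAMING: the one-bump (N = 1) cell; two bumps need a magnitude law (memo §21.3); nothing here proves
`WronskianBudgetK3` / `OneChangeFloorK3` / the stubs / 18050 / `MatrixDescartes`; `VP ≠ VNP` is NOT proved.  No definitions, no named facts.
-/

set_option linter.dupNamespace false

namespace Summit.ValiantsHypothesis.ValiantsHypothesis.Theorems.LacunarySymmetroidMatrixDescartes

namespace ProductPlusOne

open Finset
open scoped BigOperators

/-! ### §1 The identity and the two pointwise laws -/

section Row

variable (e₁ e₂ : ℕ) (A B C : ℝ)

/-- ★ **BACKGROUND LAW:** `ψ₁ > 0` and `βγ·(A·u) ≥ 0` at `x` ⇒ `ψ₃ > 0` and `ψ₂² ≤ ψ₁·ψ₃` — the row's field `−ψ₁` is a negative,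
log-convex pull there.  Instances: unswitched incoherent rows, switched coherent rows, one-change binomials on any pair (either side).
Corollary of ✓ `rowPsi_logConvex_of` (`…WWIdentity`), whose hypothesis `0 ≤ ABC·x^{p+q}·u³` equals `βγ·(Au)·u²` up to grouping. [this file's corollary] -/
theorem background_law {x : ℝ}
    (hψ1 : 0 < rowPsi1 e₁ e₂ A B C x) (hsign : 0 ≤ (B * x ^ (e₁ + 1)) * (C * x ^ (e₁ + e₂ + 2)) * (A * rowU e₁ e₂ A B C x)) :
    0 < rowPsi3 e₁ e₂ A B C x ∧ rowPsi2 e₁ e₂ A B C x ^ 2 ≤ rowPsi1 e₁ e₂ A B C x * rowPsi3 e₁ e₂ A B C x := by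
  have hc : 0 ≤ A * B * C * x ^ (e₁ + 1 + (e₁ + e₂ + 2)) * rowU e₁ e₂ A B C x ^ 3 := by
    have : A * B * C * x ^ (e₁ + 1 + (e₁ + e₂ + 2)) * rowU e₁ e₂ A B C x ^ 3
        = ((B * x ^ (e₁ + 1)) * (C * x ^ (e₁ + e₂ + 2)) * (A * rowU e₁ e₂ A B C x)) * rowU e₁ e₂ A B C x ^ 2 := by ring
    rw [this]; exact mul_nonneg hsign (sq_nonneg _)
  have hgap := rowPsi_logConvex_of e₁ e₂ A B C hψ1 hc
  refine ⟨?_, hgap.le⟩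
  by_contra hle
  push Not at hle
  have : rowPsi1 e₁ e₂ A B C x * rowPsi3 e₁ e₂ A B C x ≤ 0 := mul_nonpos_of_nonneg_of_nonpos hψ1.le hle
  linarith [sq_nonneg (rowPsi2 e₁ e₂ A B C x)]

/-- **Binomial on the pair `(0,1)`** (`C = 0`): `ψ₁ = p²·β·A·u²`. [this file's lemma] -/
theorem pair01_rowPsi1_eq {x : ℝ} (hF : A - B * x ^ (e₁ + 1) ≠ 0) :
    rowPsi1 e₁ e₂ A B 0 x = ((e₁ : ℝ) + 1) ^ 2 * (B * x ^ (e₁ + 1)) * A * rowU e₁ e₂ A B 0 x ^ 2 := by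
  unfold rowPsi1 rowH rowU
  simp only [mul_zero, zero_mul, add_zero, sub_zero]
  field_simp
  ring

/-- **Binomial on the pair `(1,2)`** (`A = 0`): `ψ₁ = −(q−p)²·βγ·u²`. [this file's lemma] -/
theorem pair12_rowPsi1_eq {x : ℝ} (hF : (0 : ℝ) - B * x ^ (e₁ + 1) - C * x ^ (e₁ + e₂ + 2) ≠ 0) :
    rowPsi1 e₁ e₂ 0 B C x = -(((e₂ : ℝ) + 1) ^ 2 * ((B * x ^ (e₁ + 1)) * (C * x ^ (e₁ + e₂ + 2)))) * rowU e₁ e₂ 0 B C x ^ 2 := by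
  unfold rowPsi1 rowH rowU
  field_simp
  ring

/-- **One-change binomial on `(0,1)`** (`C = 0`, `A·B > 0`, i.e. letters `a₀, a₁` of opposite signs): `ψ₁ > 0` off its root. [this file's lemma] -/
theorem pair01_pole_rowPsi1_pos {x : ℝ} (hx : 0 < x) (hAB : 0 < A * B) (hF : A - B * x ^ (e₁ + 1) ≠ 0) :
    0 < rowPsi1 e₁ e₂ A B 0 x := by
  rw [pair01_rowPsi1_eq e₁ e₂ A B hF]
  have hu : rowU e₁ e₂ A B 0 x ≠ 0 := by unfold rowU; simp only [zero_mul, sub_zero]; exact inv_ne_zero hF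
  have h1 : 0 < ((e₁ : ℝ) + 1) ^ 2 * (B * x ^ (e₁ + 1)) * A := by
    have : ((e₁ : ℝ) + 1) ^ 2 * (B * x ^ (e₁ + 1)) * A = ((e₁ : ℝ) + 1) ^ 2 * x ^ (e₁ + 1) * (A * B) := by ring
    rw [this]; positivity
  exact mul_pos h1 (by positivity)

/-- **One-signed binomial on `(0,1)`** (`C = 0`, `A·B < 0`): `ψ₁ < 0` everywhere on `(0,∞)` (a knee of rate `p`). [this file's lemma] -/
theorem pair01_knee_rowPsi1_neg {x : ℝ} (hx : 0 < x) (hAB : A * B < 0) :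
    rowPsi1 e₁ e₂ A B 0 x < 0 := by
  have hF : A - B * x ^ (e₁ + 1) ≠ 0 := by
    intro h
    have hA : A = B * x ^ (e₁ + 1) := by linarith
    rw [hA] at hAB
    have : 0 ≤ B * x ^ (e₁ + 1) * B := by
      have := sq_nonneg B; nlinarith [pow_pos hx (e₁ + 1)]
    linarith
  rw [pair01_rowPsi1_eq e₁ e₂ A B hF]
  have hu : rowU e₁ e₂ A B 0 x ≠ 0 := by unfold rowU; simp only [zero_mul, sub_zero]; exact inv_ne_zero hF
  have h1 : ((e₁ : ℝ) + 1) ^ 2 * (B * x ^ (e₁ + 1)) * A < 0 := by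
    have : ((e₁ : ℝ) + 1) ^ 2 * (B * x ^ (e₁ + 1)) * A = ((e₁ : ℝ) + 1) ^ 2 * x ^ (e₁ + 1) * (A * B) := by ring
    rw [this]
    exact mul_neg_of_pos_of_neg (by positivity) hAB
  exact mul_neg_of_neg_of_pos h1 (by positivity)

/-- **One-change binomial on `(1,2)`** (`A = 0`, `B·C < 0`): `ψ₁ > 0` off its root (a pole of rate `q − p`). [this file's lemma] -/
theorem pair12_pole_rowPsi1_pos {x : ℝ} (hx : 0 < x) (hBC : B * C < 0) (hF : (0 : ℝ) - B * x ^ (e₁ + 1) - C * x ^ (e₁ + e₂ + 2) ≠ 0) :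
    0 < rowPsi1 e₁ e₂ 0 B C x := by
  rw [pair12_rowPsi1_eq e₁ e₂ B C hF]
  have hu : rowU e₁ e₂ 0 B C x ≠ 0 := by unfold rowU; exact inv_ne_zero hF
  have hβγ : (B * x ^ (e₁ + 1)) * (C * x ^ (e₁ + e₂ + 2)) < 0 := by
    have : (B * x ^ (e₁ + 1)) * (C * x ^ (e₁ + e₂ + 2)) = (x ^ (e₁ + 1) * x ^ (e₁ + e₂ + 2)) * (B * C) := by ring
    rw [this]; exact mul_neg_of_pos_of_neg (by positivity) hBC
  have h1 : 0 < -(((e₂ : ℝ) + 1) ^ 2 * ((B * x ^ (e₁ + 1)) * (C * x ^ (e₁ + e₂ + 2)))) := by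
    have : ((e₂ : ℝ) + 1) ^ 2 * ((B * x ^ (e₁ + 1)) * (C * x ^ (e₁ + e₂ + 2))) < 0 := mul_neg_of_pos_of_neg (by positivity) hβγ
    linarith
  exact mul_pos h1 (by positivity)

/-- **One-signed binomial on `(1,2)`** (`A = 0`, `B·C > 0`): `ψ₁ < 0` everywhere on `(0,∞)` (a knee of rate `q − p`). [this file's lemma] -/
theorem pair12_knee_rowPsi1_neg {x : ℝ} (hx : 0 < x) (hBC : 0 < B * C) :
    rowPsi1 e₁ e₂ 0 B C x < 0 := by
  have hβγ : 0 < (B * x ^ (e₁ + 1)) * (C * x ^ (e₁ + e₂ + 2)) := by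
    have : (B * x ^ (e₁ + 1)) * (C * x ^ (e₁ + e₂ + 2)) = (x ^ (e₁ + 1) * x ^ (e₁ + e₂ + 2)) * (B * C) := by ring
    rw [this]; positivity
  have hF : (0 : ℝ) - B * x ^ (e₁ + 1) - C * x ^ (e₁ + e₂ + 2) ≠ 0 := by
    intro h
    have hB : B * x ^ (e₁ + 1) = -(C * x ^ (e₁ + e₂ + 2)) := by linarith
    rw [hB] at hβγ
    nlinarith [sq_nonneg (C * x ^ (e₁ + e₂ + 2))]
  rw [pair12_rowPsi1_eq e₁ e₂ B C hF]
  have hu : rowU e₁ e₂ 0 B C x ≠ 0 := by unfold rowU; exact inv_ne_zero hF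
  have h1 : -(((e₂ : ℝ) + 1) ^ 2 * ((B * x ^ (e₁ + 1)) * (C * x ^ (e₁ + e₂ + 2)))) < 0 := by
    have : 0 < ((e₂ : ℝ) + 1) ^ 2 * ((B * x ^ (e₁ + 1)) * (C * x ^ (e₁ + e₂ + 2))) := by positivity
    linarith
  exact mul_neg_of_neg_of_pos h1 (by positivity)

/-- **One-change binomial on `(0,2)`** (`B = 0`, `A·C > 0`): `ψ₁ > 0` off its root (a pole of rate `q`). [this file's lemma] -/
theorem pair02_pole_rowPsi1_pos {x : ℝ} (hx : 0 < x) (hAC : 0 < A * C) (hF : A - C * x ^ (e₁ + e₂ + 2) ≠ 0) :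
    0 < rowPsi1 e₁ e₂ A 0 C x := by
  rw [knee_rowPsi1_eq e₁ e₂ A C hF]
  have hu : rowU e₁ e₂ A 0 C x ≠ 0 := by unfold rowU; simp only [zero_mul, sub_zero]; exact inv_ne_zero hF
  have h1 : 0 < ((e₁ : ℝ) + e₂ + 2) ^ 2 * (A * C) * x ^ (e₁ + e₂ + 2) := by positivity
  exact mul_pos h1 (by positivity)

end Row

/-! ### §2 A background cloud is a log-convex pull -/

section Cloud

variable (e₁ e₂ : ℕ) {ι : Type*} {s : Finset ι} {m A B C : ι → ℝ}

/-- **Background cloud.**  At `x`, every row of the nonempty weighted cloud (`m_i > 0`) is off its zero and satisfies the background law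
(`ψ₁ > 0`, `βγ·(A·u) ≥ 0`) ⇒ `P1 > 0` and `P2² ≤ P1·P3`. [this file's theorem] -/
theorem backgroundCloud_lcP1 {x : ℝ} (hs : s.Nonempty) (hm : ∀ i ∈ s, 0 < m i)
    (hrow : ∀ i ∈ s, A i - B i * x ^ (e₁ + 1) - C i * x ^ (e₁ + e₂ + 2) ≠ 0 ∧ 0 < rowPsi1 e₁ e₂ (A i) (B i) (C i) x ∧
      0 ≤ (B i * x ^ (e₁ + 1)) * (C i * x ^ (e₁ + e₂ + 2)) * (A i * rowU e₁ e₂ (A i) (B i) (C i) x)) :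
    0 < cloudP1 e₁ e₂ s m A B C x ∧ cloudP2 e₁ e₂ s m A B C x ^ 2 ≤ cloudP1 e₁ e₂ s m A B C x * cloudP3 e₁ e₂ s m A B C x := by
  have hψ : ∀ i ∈ s, 0 < rowPsi1 e₁ e₂ (A i) (B i) (C i) x ∧ 0 ≤ rowPsi3 e₁ e₂ (A i) (B i) (C i) x ∧
      rowPsi2 e₁ e₂ (A i) (B i) (C i) x ^ 2 ≤ rowPsi1 e₁ e₂ (A i) (B i) (C i) x * rowPsi3 e₁ e₂ (A i) (B i) (C i) x := by
    intro i hi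
    obtain ⟨_, h1, hsg⟩ := hrow i hi
    obtain ⟨h3, hlc⟩ := background_law e₁ e₂ (A i) (B i) (C i) h1 hsg
    exact ⟨h1, h3.le, hlc⟩
  refine ⟨?_, ?_⟩
  · unfold cloudP1
    exact Finset.sum_pos (fun i hi => mul_pos (hm i hi) (hψ i hi).1) hs
  · unfold cloudP1 cloudP2 cloudP3
    refine lc_sum s _ _ _ (fun i hi => mul_nonneg (hm i hi).le (hψ i hi).1.le)
      (fun i hi => mul_nonneg (hm i hi).le (hψ i hi).2.1) ?_
    intro i hi
    have h := (hψ i hi).2.2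
    have hm2 : 0 ≤ m i ^ 2 := sq_nonneg _
    calc (m i * rowPsi2 e₁ e₂ (A i) (B i) (C i) x) ^ 2 = m i ^ 2 * rowPsi2 e₁ e₂ (A i) (B i) (C i) x ^ 2 := by ring
      _ ≤ m i ^ 2 * (rowPsi1 e₁ e₂ (A i) (B i) (C i) x * rowPsi3 e₁ e₂ (A i) (B i) (C i) x) := mul_le_mul_of_nonneg_left h hm2
      _ = m i * rowPsi1 e₁ e₂ (A i) (B i) (C i) x * (m i * rowPsi3 e₁ e₂ (A i) (B i) (C i) x) := by ring

end Cloud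

/-! ### §3 One bump against a background cloud -/

/-- ★★ **ONE BUMP versus a BACKGROUND CLOUD: no three zeros.**  Row `a − bx^p − cx^q` off its zero on `[x₁, x₃] ⊂ (0,∞)` with `ψ₁ < 0` and
`βγ·(a·u) ≤ 0` there (a bump: one-signed binomial on any pair / switched incoherent riser past its turning / rising unswitched coherent row); nonempty
weighted cloud satisfying the background law pointwise on the window ⇒ `ψ₁ + cloudP1` does not vanish at three points `x₁ < x₂ < x₃`. [this file's theorem] -/
theorem hump_backgroundCloud_no_three_zeros (e₁ e₂ : ℕ) (a b c : ℝ)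
    {ι : Type*} (s : Finset ι) (hs : s.Nonempty) (m A B C : ι → ℝ) (hm : ∀ i ∈ s, 0 < m i)
    {x₁ x₂ x₃ : ℝ} (h0 : 0 < x₁) (h12 : x₁ < x₂) (h23 : x₂ < x₃)
    (hF : ∀ x ∈ Set.Icc x₁ x₃, a - b * x ^ (e₁ + 1) - c * x ^ (e₁ + e₂ + 2) ≠ 0)
    (hpost : ∀ x ∈ Set.Icc x₁ x₃, rowPsi1 e₁ e₂ a b c x < 0)
    (hsign : ∀ x ∈ Set.Icc x₁ x₃, (b * x ^ (e₁ + 1)) * (c * x ^ (e₁ + e₂ + 2)) * (a * rowU e₁ e₂ a b c x) ≤ 0)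
    (hrow : ∀ x ∈ Set.Icc x₁ x₃, ∀ i ∈ s, A i - B i * x ^ (e₁ + 1) - C i * x ^ (e₁ + e₂ + 2) ≠ 0 ∧
      0 < rowPsi1 e₁ e₂ (A i) (B i) (C i) x ∧ 0 ≤ (B i * x ^ (e₁ + 1)) * (C i * x ^ (e₁ + e₂ + 2)) * (A i * rowU e₁ e₂ (A i) (B i) (C i) x))
    (hzero : ∀ x ∈ ({x₁, x₂, x₃} : Set ℝ), rowPsi1 e₁ e₂ a b c x + cloudP1 e₁ e₂ s m A B C x = 0) : False := by
  have hx0 : ∀ x ∈ Set.Icc x₁ x₃, 0 < x := fun x hx => h0.trans_le hx.1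
  have hne : ∀ x ∈ Set.Icc x₁ x₃, ∀ i ∈ s, A i - B i * x ^ (e₁ + 1) - C i * x ^ (e₁ + e₂ + 2) ≠ 0 :=
    fun x hx i hi => (hrow x hx i hi).1
  exact slope_no_three_zeros_of_pull e₁ e₂ a b c (cloudP1 e₁ e₂ s m A B C) (cloudP2 e₁ e₂ s m A B C) (cloudP3 e₁ e₂ s m A B C)
    h0 h12 h23 hF hpost (fun x hx => slope_logConcave_of_sign e₁ e₂ a b c (hF x hx) (hsign x hx) (hpost x hx))
    (fun x hx => (backgroundCloud_lcP1 e₁ e₂ hs hm (hrow x hx)).1)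
    (fun x hx => mixedCloud_hasDerivAt1 e₁ e₂ s m A B C (hx0 x hx) (hne x hx))
    (fun x hx => mixedCloud_hasDerivAt2 e₁ e₂ s m A B C (hx0 x hx) (hne x hx))
    (fun x hx => (backgroundCloud_lcP1 e₁ e₂ hs hm (hrow x hx)).2) hzero

/-! ### §4 Two one-row tools for the LINE-currency menu -/

/-- A binomial `g = α + β·x^n` whose endpoint values on `[u,v] ⊂ (0,∞)` have a positive product keeps the sign of `g(u)` on the window. [folklore] -/
theorem binomial_sign_const (α β : ℝ) (n : ℕ) {u v : ℝ} (hu : 0 < u) (hprod : 0 < (α + β * u ^ n) * (α + β * v ^ n))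
    {x : ℝ} (hx : x ∈ Set.Icc u v) : 0 < (α + β * u ^ n) * (α + β * x ^ n) := by
  have hxu : u ^ n ≤ x ^ n := pow_le_pow_left₀ hu.le hx.1 _
  have hxv : x ^ n ≤ v ^ n := pow_le_pow_left₀ (hu.le.trans hx.1) hx.2 _
  rcases le_or_gt 0 β with hβ | hβ
  · have h1 : α + β * u ^ n ≤ α + β * x ^ n := by nlinarith [mul_le_mul_of_nonneg_left hxu hβ]
    have h2 : α + β * x ^ n ≤ α + β * v ^ n := by nlinarith [mul_le_mul_of_nonneg_left hxv hβ]
    rcases lt_or_ge 0 (α + β * u ^ n) with hgu | hgu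
    · exact mul_pos hgu (hgu.trans_le h1)
    · have hgv : α + β * v ^ n < 0 := by
        by_contra h; push Not at h
        have : (α + β * u ^ n) * (α + β * v ^ n) ≤ 0 := mul_nonpos_of_nonpos_of_nonneg hgu h
        linarith
      have hgx : α + β * x ^ n < 0 := h2.trans_lt hgv
      have hgu' : α + β * u ^ n < 0 := lt_of_le_of_ne hgu (fun h => by rw [h, zero_mul] at hprod; exact lt_irrefl 0 hprod)
      exact mul_pos_of_neg_of_neg hgu' hgx
  · have h1 : α + β * x ^ n ≤ α + β * u ^ n := by nlinarith [mul_le_mul_of_nonpos_left hxu hβ.le]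
    have h2 : α + β * v ^ n ≤ α + β * x ^ n := by nlinarith [mul_le_mul_of_nonpos_left hxv hβ.le]
    rcases lt_or_ge 0 (α + β * u ^ n) with hgu | hgu
    · have hgv : 0 < α + β * v ^ n := by
        by_contra h; push Not at h
        have : (α + β * u ^ n) * (α + β * v ^ n) ≤ 0 := mul_nonpos_of_nonneg_of_nonpos hgu.le h
        linarith
      exact mul_pos hgu (hgv.trans_le h2)
    · have hgu' : α + β * u ^ n < 0 := lt_of_le_of_ne hgu (fun h => by rw [h, zero_mul] at hprod; exact lt_irrefl 0 hprod)
      exact mul_pos_of_neg_of_neg hgu' (h1.trans_lt hgu')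

/-- **Unswitched coherent row: the rising phase is an initial segment.**  Normal form `A > 0`, `B < 0 < C`; if `ψ₁(x₃) ≤ 0` (off the zero) then
`ψ₁(x) < 0` at every `0 < x < x₃` off the zero: `ψ₁ = u²·x^p·k(x)` with `k(x) = A p²B + A q²C x^{q−p} − (q−p)²BC x^q` strictly increasing.
[this file's lemma] -/
theorem coherent_rowPsi1_neg_of_lt (e₁ e₂ : ℕ) (A B C : ℝ) (hA : 0 < A) (hB : B < 0) (hC : 0 < C) {x x₃ : ℝ} (hx : 0 < x) (hlt : x < x₃)
    (hF : A - B * x ^ (e₁ + 1) - C * x ^ (e₁ + e₂ + 2) ≠ 0) (hF3 : A - B * x₃ ^ (e₁ + 1) - C * x₃ ^ (e₁ + e₂ + 2) ≠ 0)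
    (h3 : rowPsi1 e₁ e₂ A B C x₃ ≤ 0) : rowPsi1 e₁ e₂ A B C x < 0 := by
  have hx3 : 0 < x₃ := hx.trans hlt
  -- the bracket `k`
  set k : ℝ → ℝ := fun y => A * (((e₁ : ℝ) + 1) ^ 2 * B) + A * (((e₁ : ℝ) + e₂ + 2) ^ 2 * C) * y ^ (e₂ + 1)
    - ((e₂ : ℝ) + 1) ^ 2 * (B * C) * y ^ (e₁ + e₂ + 2) with hk
  have hrepr : ∀ y, A - B * y ^ (e₁ + 1) - C * y ^ (e₁ + e₂ + 2) ≠ 0 →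
      rowPsi1 e₁ e₂ A B C y = rowU e₁ e₂ A B C y ^ 2 * y ^ (e₁ + 1) * k y := by
    intro y hy
    rw [rowPsi1_eq_sq_mul e₁ e₂ A B C hy, hk]
    unfold rowH
    ring
  have hkmono : k x < k x₃ := by
    have h1 : x ^ (e₂ + 1) < x₃ ^ (e₂ + 1) := pow_lt_pow_left₀ hlt hx.le (by omega)
    have h2 : x ^ (e₁ + e₂ + 2) < x₃ ^ (e₁ + e₂ + 2) := pow_lt_pow_left₀ hlt hx.le (by omega)
    have hc1 : 0 < A * (((e₁ : ℝ) + e₂ + 2) ^ 2 * C) := by positivity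
    have hc2 : 0 < -(((e₂ : ℝ) + 1) ^ 2 * (B * C)) := by
      have : B * C < 0 := mul_neg_of_neg_of_pos hB hC
      have : ((e₂ : ℝ) + 1) ^ 2 * (B * C) < 0 := mul_neg_of_pos_of_neg (by positivity) this
      linarith
    simp only [hk]
    nlinarith [mul_lt_mul_of_pos_left h1 hc1, mul_lt_mul_of_pos_left h2 hc2]
  have hu3 : rowU e₁ e₂ A B C x₃ ≠ 0 := by unfold rowU; exact inv_ne_zero hF3
  have hk3 : k x₃ ≤ 0 := by
    rw [hrepr x₃ hF3] at h3
    have hpos : 0 < rowU e₁ e₂ A B C x₃ ^ 2 * x₃ ^ (e₁ + 1) := by positivity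
    by_contra hgt
    push Not at hgt
    have : 0 < rowU e₁ e₂ A B C x₃ ^ 2 * x₃ ^ (e₁ + 1) * k x₃ := mul_pos hpos hgt
    linarith
  have hu : rowU e₁ e₂ A B C x ≠ 0 := by unfold rowU; exact inv_ne_zero hF
  rw [hrepr x hF]
  have hpos : 0 < rowU e₁ e₂ A B C x ^ 2 * x ^ (e₁ + 1) := by positivity
  exact mul_neg_of_pos_of_neg hpos (by linarith)


end ProductPlusOne

end Summit.ValiantsHypothesis.ValiantsHypothesis.Theorems.LacunarySymmetroidMatrixDescartes
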